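import Summits.BirchSwinnertonDyer.BirchSwinnertonDyer.Theorems.ByReductionTypeAtTwoMultTransportFrobenius
import HarnessLib

/-!
# T-42-mult in the kernel, split targets II: at a SPLIT multiplicative `2`, `√γ(E) = √(−c₄/c₆)` lies in
# `ℚ₂` — every `σ ∈ Γ_{ℚ₂}` fixes `t`, `t² = γ`

Cell `bsd-2adic` (run/shared/lean/pub/bsd-2adic/), seat `bsd-2adic-t42` (BRIEF-T42, DESIGN-T42 §5 item
T5: the SPLIT targets of `X5.O1.MultCongruenceTransportAtTwo`). HONEST FRAMING: research route;
theorems only (no `def`, no named fact, nothing booked).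

WHAT THIS FILE PROVES (`E/ℚ` globally minimal, SPLIT multiplicative at `2`, `v ∋ 2`, `t ∈ ℚ̄_v` with
`t² = γ = −c₄/c₆`): **`smul_sqrt_gamma_eq_of_split_two`** — `σ t = t` for every `σ ∈ Γ_{ℚ_v}`
(Silverman *ATAEC* V.5.3 (b): split multiplicative iff `γ ∈ (K^×)²`, here at `p = 2` where the
criterion is NOT a Legendre symbol). It is the converse companion of file I-a
(`frob_smul_sqrt_gamma_eq_neg_two`: at a NON-split `2` a Frobenius flips `t`). Proof, `2`-adic and
Hensel-free: the two roots `T_± = (±c₆t − a₁c₄)/(2c₄)` of the node-tangent quadratic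
`c₄T² + a₁c₄T − C` (`C = 54b₆ − 3b₂b₄ + a₂c₄`, discriminant `−c₄c₆`, tree
`WeierstrassCurve.discrim_nodalTangents`) are `v`-adic integers with `T_+ + T_- = −a₁` (a `2`-unit:
`a₁` is odd) and `T_+T_- = −C/c₄`; SPLIT reduction means the quadratic has a root mod `2`, i.e. `2 ∣ C`
(tree `IntModel.not_hasSplitMultiplicativeReductionAtPrime_of_intModel_of_noroot`), so one of `T_±` has
valuation `< 1`; a `σ` with `σt = −t` swaps `T_+` and `T_-` and is an ISOMETRY of the spectral
valuation (Mathlib `spectralNorm_eq_of_equiv`), so both would have valuation `< 1`,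
contradicting `|T_+ + T_-|_v = |a₁|_v = 1`. Consequence used downstream (file DataSplit): at a split
`2` the TWISTED Tate parametrisation of Silverman V.5.3/Cor. V.5.4 (`σ·Ψ(u) = χ(σ)Ψ(σu)`,
`χ(σ) = σt/t`) is plainly `Γ_{ℚ₂}`-equivariant, so `Γ_{ℚ₂}` acts trivially on `E[2^∞]/C₂`.

References: [SilvermanATAEC1994] V Lemma 5.2 (c), Thm. 5.3 (a),(b), Cor. 5.4, Ex. 5.11;
[SilvermanAEC2009] VII.5 Prop. 5.1(b); [NeukirchANT1999] II (4.8) (uniqueness of the extended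
valuation: `Γ_{K_v}` acts by isometries).
-/

set_option autoImplicit false
set_option linter.dupNamespace false

noncomputable section

open scoped Classical AddSubgroup NNReal

universe u

namespace Summit.BirchSwinnertonDyer.BirchSwinnertonDyer.Theorems.MultTransportAtTwo

open NumberField IsDedekindDomain Field Polynomial Literature.NumberTheory.GaloisRepresentations
  Literature.NumberTheory.EllipticCurves Literature.NumberTheory.EllipticCurves.GreenbergSelmer
  Literature.NumberTheory.EllipticCurves.GreenbergVatsal2000
  Literature.NumberTheory.EllipticCurves.Greenberg1999
  Literature.NumberTheory.EllipticCurves.ResKernel IsDedekindDomain.HeightOneSpectrum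
  Rat.HeightOneSpectrum
  Summit.BirchSwinnertonDyer.Rank1Residual
  Summit.BirchSwinnertonDyer.Rank1Residual.X2
  Summit.BirchSwinnertonDyer.Rank1Residual.X2.GreenbergVatsalReductionDatum
open WeierstrassCurve (minimalDiscriminantInt integralModelInt)

section Split

variable (W : WeierstrassCurve ℚ) [W.IsElliptic] [W.IsGloballyMinimal] {v : HeightOneSpectrum (𝓞 ℚ)}

/-- At a SPLIT multiplicative `2` the node-tangent constant `C = 54b₆ − 3b₂b₄ + a₂c₄` of the integral
minimal model is EVEN: the node-tangent quadratic `c₄T² + a₁c₄T − C ≡ T² + T + C (mod 2)` (`c₄`, `a₁`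
odd) has a root mod `2` iff `C` is even. Silverman, *AEC* VII.5.1(b). [cite: SilvermanAEC2009, VII.5 Prop. 5.1(b)] -/
theorem two_dvd_nodal_const_of_split_two (hsp : W.HasSplitMultiplicativeReductionAtPrime 2) :
    (2 : ℤ) ∣ 54 * (integralModelInt W).b₆ - 3 * (integralModelInt W).b₂ * (integralModelInt W).b₄ +
      (integralModelInt W).a₂ * (integralModelInt W).c₄ := by
  have hmult : W.HasMultiplicativeReductionAtPrime 2 := hsp.hasMultiplicativeReductionAtPrime
  obtain ⟨hΔ, hc₄⟩ := Additive.dvd_and_not_dvd_c₄_of_hasMultiplicativeReductionAtPrime W 2 hmult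
  rw [Nat.cast_ofNat] at hΔ hc₄
  set E₀ := integralModelInt W with hE₀
  obtain ⟨m, hm⟩ := odd_a₁_of_not_two_dvd_c₄ E₀ hc₄
  by_contra hC
  refine BirchSwinnertonDyer.Rank1Residual.IntModel.not_hasSplitMultiplicativeReductionAtPrime_of_intModel_of_noroot
    (W := W) (E₀ := E₀) hE₀.symm 2 (by exact_mod_cast hΔ) (by exact_mod_cast hc₄) ?_ hsp
  have key1 : ∀ y : ZMod 2, y ≠ 0 → y = 1 := by decide
  have key : ∀ z : ℤ, ¬ (2 : ℤ) ∣ z → (z : ZMod 2) = 1 := by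
    intro z hz
    refine key1 _ fun h0 ↦ hz ?_
    exact_mod_cast (ZMod.intCast_zmod_eq_zero_iff_dvd z 2).1 h0
  have hc₄' : ((E₀.c₄ : ℤ) : ZMod 2) = 1 := key _ hc₄
  have ha₁' : ((E₀.a₁ : ℤ) : ZMod 2) = 1 := key _ (by rw [hm]; omega)
  have hC' : ((54 * E₀.b₆ - 3 * E₀.b₂ * E₀.b₄ + E₀.a₂ * E₀.c₄ : ℤ) : ZMod 2) = 1 := key _ hC
  push_cast at hC'
  have key2 : ∀ r : ZMod 2, r ^ 2 + r - 1 ≠ 0 := by decide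
  intro r heq
  refine key2 r ?_
  linear_combination heq + (-(r ^ 2) - ((E₀.a₁ : ℤ) : ZMod 2) * r) * hc₄' + (-r) * ha₁' + hC'

/-- **At a SPLIT multiplicative `2`, `√γ ∈ ℚ₂`: every `σ ∈ Γ_{ℚ_v}` fixes `t`, `t² = γ = −c₄/c₆`**
(`v ∋ 2`, `E/ℚ` globally minimal). Silverman *ATAEC* V.5.3 (b) ("split multiplicative iff
`γ ∈ (K^×)²`") at `p = 2`, proved `2`-adically: the roots `T_± = (±c₆t − a₁c₄)/(2c₄)` of the
node-tangent quadratic are `v`-integral with `T_+ + T_- = −a₁` (odd) and `T_+T_- = −C/c₄` with `C`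
even (split), so exactly one of `T_±` is a non-unit; `σt = −t` would swap them, but `σ` is an
isometry. [cite: SilvermanATAEC1994, Ch. V Lemma 5.2 (c), Thm. 5.3 (a),(b), Cor. 5.4]
[cite: SilvermanAEC2009, VII.5 Prop. 5.1(b)] [cite: NeukirchANT1999, Ch. II (4.8)] -/
theorem smul_sqrt_gamma_eq_of_split_two (hsp : W.HasSplitMultiplicativeReductionAtPrime 2)
    (h2v : ((2 : ℕ) : 𝓞 ℚ) ∈ v.asIdeal) (t : AlgebraicClosure (v.adicCompletion ℚ))
    (ht : t ^ 2 = algebraMap (v.adicCompletion ℚ) (AlgebraicClosure (v.adicCompletion ℚ))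
      (algebraMap ℚ (v.adicCompletion ℚ) (-(W.c₄ / W.c₆))))
    (σ : absoluteGaloisGroup (v.adicCompletion ℚ)) : σ • t = t := by
  haveI : CharZero (AlgebraicClosure (v.adicCompletion ℚ)) :=
    charZero_of_injective_algebraMap (algebraMap ℚ (AlgebraicClosure (v.adicCompletion ℚ))).injective
  have hmult : W.HasMultiplicativeReductionAtPrime 2 := hsp.hasMultiplicativeReductionAtPrime
  obtain ⟨w, hw⟩ := v.exists_spectralValuation
  obtain ⟨hΔ, hc₄⟩ := Additive.dvd_and_not_dvd_c₄_of_hasMultiplicativeReductionAtPrime W 2 hmult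
  have hc₆ := X2.GreenbergVatsalTateDatumRat.not_dvd_c₆_of_hasMultiplicativeReductionAtPrime W hmult
  rw [Nat.cast_ofNat] at hΔ hc₄ hc₆
  have h2C := two_dvd_nodal_const_of_split_two W hsp
  set E₀ := integralModelInt W with hE₀
  have h4 : W.c₄ = (E₀.c₄ : ℚ) := by
    conv_lhs => rw [← WeierstrassCurve.map_integralModelInt W]
    rw [WeierstrassCurve.map_c₄, eq_intCast]
  have h6 : W.c₆ = (E₀.c₆ : ℚ) := by
    conv_lhs => rw [← WeierstrassCurve.map_integralModelInt W]
    rw [WeierstrassCurve.map_c₆, eq_intCast]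
  have hγ : algebraMap (v.adicCompletion ℚ) (AlgebraicClosure (v.adicCompletion ℚ)) (algebraMap ℚ (v.adicCompletion ℚ) (-(W.c₄ / W.c₆))) =
      -(((E₀.c₄ : ℤ) : AlgebraicClosure (v.adicCompletion ℚ)) / ((E₀.c₆ : ℤ) : AlgebraicClosure (v.adicCompletion ℚ))) := by
    rw [← IsScalarTower.algebraMap_apply ℚ (v.adicCompletion ℚ)
      (AlgebraicClosure (v.adicCompletion ℚ)), h4, h6, map_neg, map_div₀,
      map_intCast, map_intCast]
  have hw4 : w ((E₀.c₄ : ℤ) : AlgebraicClosure (v.adicCompletion ℚ)) = 1 :=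
    spectralValuation_intCast_eq_one_of_natCast_mem h2v hw (by rwa [Nat.cast_ofNat])
  have hw6 : w ((E₀.c₆ : ℤ) : AlgebraicClosure (v.adicCompletion ℚ)) = 1 :=
    spectralValuation_intCast_eq_one_of_natCast_mem h2v hw (by rwa [Nat.cast_ofNat])
  have hc₄0 : ((E₀.c₄ : ℤ) : AlgebraicClosure (v.adicCompletion ℚ)) ≠ 0 := by
    intro h0; rw [h0, map_zero] at hw4; exact zero_ne_one hw4
  have hc₆0 : ((E₀.c₆ : ℤ) : AlgebraicClosure (v.adicCompletion ℚ)) ≠ 0 := by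
    intro h0; rw [h0, map_zero] at hw6; exact zero_ne_one hw6
  have h20 : (2 : AlgebraicClosure (v.adicCompletion ℚ)) ≠ 0 := two_ne_zero
  -- `a₁` is odd, `C` is even
  obtain ⟨m, hm⟩ := odd_a₁_of_not_two_dvd_c₄ E₀ hc₄
  set C : ℤ := 54 * E₀.b₆ - 3 * E₀.b₂ * E₀.b₄ + E₀.a₂ * E₀.c₄ with hCdef
  have hdisc : (E₀.a₁ * E₀.c₄) ^ 2 + 4 * E₀.c₄ * C = -(E₀.c₄ * E₀.c₆) := by
    have h := WeierstrassCurve.discrim_nodalTangents E₀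
    rw [discrim] at h
    rw [hCdef]
    linear_combination h
  have hd : (((E₀.a₁ : ℤ) : AlgebraicClosure (v.adicCompletion ℚ)) * ((E₀.c₄ : ℤ) : AlgebraicClosure (v.adicCompletion ℚ))) ^ 2 + 4 * ((E₀.c₄ : ℤ) : AlgebraicClosure (v.adicCompletion ℚ)) * ((C : ℤ) : AlgebraicClosure (v.adicCompletion ℚ)) =
      -(((E₀.c₄ : ℤ) : AlgebraicClosure (v.adicCompletion ℚ)) * ((E₀.c₆ : ℤ) : AlgebraicClosure (v.adicCompletion ℚ))) := by
    have h := congrArg (fun z : ℤ ↦ (z : AlgebraicClosure (v.adicCompletion ℚ))) hdisc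
    push_cast at h
    exact h
  have hwa₁ : w ((E₀.a₁ : ℤ) : AlgebraicClosure (v.adicCompletion ℚ)) = 1 :=
    spectralValuation_intCast_eq_one_of_natCast_mem h2v hw (by rw [hm]; omega)
  have hw2 : w (2 : AlgebraicClosure (v.adicCompletion ℚ)) < 1 := by
    have := spectralValuation_natCast_lt_one hw h2v
    rwa [Nat.cast_ofNat] at this
  have hwC : w ((C : ℤ) : AlgebraicClosure (v.adicCompletion ℚ)) < 1 := by
    obtain ⟨k, hk⟩ := h2C
    have hk' : ((C : ℤ) : AlgebraicClosure (v.adicCompletion ℚ)) = 2 * ((k : ℤ) : AlgebraicClosure (v.adicCompletion ℚ)) := by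
      rw [hk]; push_cast; ring
    rw [hk', Valuation.map_mul]
    calc w (2 : AlgebraicClosure (v.adicCompletion ℚ)) * w ((k : ℤ) : AlgebraicClosure (v.adicCompletion ℚ)) ≤ w (2 : AlgebraicClosure (v.adicCompletion ℚ)) * 1 := by
          gcongr
          exact (mem_localAbsIntegers_iff_spectralValuation hw).1 (intCast_mem v.localAbsIntegers k)
      _ < 1 := by rw [mul_one]; exact hw2
  -- the two roots `T s = (c₆ s − a₁c₄)/(2c₄)`, `s = ± t`
  set T : AlgebraicClosure (v.adicCompletion ℚ) → AlgebraicClosure (v.adicCompletion ℚ) := fun s ↦ (((E₀.c₆ : ℤ) : AlgebraicClosure (v.adicCompletion ℚ)) * s - ((E₀.a₁ : ℤ) : AlgebraicClosure (v.adicCompletion ℚ)) * ((E₀.c₄ : ℤ) : AlgebraicClosure (v.adicCompletion ℚ))) /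
    (2 * ((E₀.c₄ : ℤ) : AlgebraicClosure (v.adicCompletion ℚ))) with hT
  have hsq : ∀ s : AlgebraicClosure (v.adicCompletion ℚ), s ^ 2 = t ^ 2 → (((E₀.c₆ : ℤ) : AlgebraicClosure (v.adicCompletion ℚ)) * s) ^ 2 = -(((E₀.c₄ : ℤ) : AlgebraicClosure (v.adicCompletion ℚ)) * ((E₀.c₆ : ℤ) : AlgebraicClosure (v.adicCompletion ℚ))) := by
    intro s hs
    rw [mul_pow, hs, ht, hγ]; field_simp
  -- `T s` is a root of `X² + a₁X = C/c₄`, hence a `v`-adic integer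
  have hTeq : ∀ s : AlgebraicClosure (v.adicCompletion ℚ), s ^ 2 = t ^ 2 →
      T s ^ 2 + ((E₀.a₁ : ℤ) : AlgebraicClosure (v.adicCompletion ℚ)) * T s = ((C : ℤ) : AlgebraicClosure (v.adicCompletion ℚ)) / ((E₀.c₄ : ℤ) : AlgebraicClosure (v.adicCompletion ℚ)) := by
    intro s hs
    have hs' := hsq s hs
    simp only [hT]
    field_simp
    linear_combination hs' - hd
  have hwa₁le : w ((E₀.a₁ : ℤ) : AlgebraicClosure (v.adicCompletion ℚ)) ≤ 1 := hwa₁.le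
  have hwCle : w ((C : ℤ) : AlgebraicClosure (v.adicCompletion ℚ)) ≤ 1 := hwC.le
  have hTint : ∀ s : AlgebraicClosure (v.adicCompletion ℚ), s ^ 2 = t ^ 2 → w (T s) ≤ 1 := by
    intro s hs
    by_contra hlt
    rw [not_le] at hlt
    have hval : w (T s ^ 2 + ((E₀.a₁ : ℤ) : AlgebraicClosure (v.adicCompletion ℚ)) * T s) ≤ 1 := by
      rw [hTeq s hs, map_div₀, hw4, div_one]; exact hwCle
    have hu1 : w (T s + ((E₀.a₁ : ℤ) : AlgebraicClosure (v.adicCompletion ℚ))) = w (T s) := by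
      rw [Valuation.map_add_eq_of_lt_left]
      exact lt_of_le_of_lt hwa₁le hlt
    have : w (T s ^ 2 + ((E₀.a₁ : ℤ) : AlgebraicClosure (v.adicCompletion ℚ)) * T s) = w (T s) ^ 2 := by
      rw [show T s ^ 2 + ((E₀.a₁ : ℤ) : AlgebraicClosure (v.adicCompletion ℚ)) * T s = T s * (T s + ((E₀.a₁ : ℤ) : AlgebraicClosure (v.adicCompletion ℚ))) by ring,
        Valuation.map_mul, hu1, pow_two]
    rw [this] at hval
    exact absurd hval (not_le.mpr (one_lt_pow₀ hlt two_ne_zero))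
  have htt : t ^ 2 = t ^ 2 := rfl
  have hnt : (-t) ^ 2 = t ^ 2 := by ring
  -- Vieta: `T t + T (−t) = −a₁`, `T t · T (−t) = −C/c₄`
  have hsum : T t + T (-t) = -((E₀.a₁ : ℤ) : AlgebraicClosure (v.adicCompletion ℚ)) := by
    simp only [hT]; field_simp; ring
  have hprod : T t * T (-t) = -(((C : ℤ) : AlgebraicClosure (v.adicCompletion ℚ)) / ((E₀.c₄ : ℤ) : AlgebraicClosure (v.adicCompletion ℚ))) := by
    have hs' := hsq t htt
    simp only [hT]
    field_simp
    linear_combination (-1 : AlgebraicClosure (v.adicCompletion ℚ)) * hs' + hd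
  -- one of the two roots is a non-unit
  have hone : w (T t) < 1 ∨ w (T (-t)) < 1 := by
    have hlt : w (T t * T (-t)) < 1 := by
      rw [hprod, Valuation.map_neg, map_div₀, hw4, div_one]; exact hwC
    rw [Valuation.map_mul] at hlt
    by_contra hcon
    rw [not_or, not_lt, not_lt] at hcon
    exact absurd hlt (not_lt.mpr (one_le_mul_of_one_le_of_one_le hcon.1 hcon.2))
  -- `σ` is an isometry of `w`
  have hwσ : ∀ x : AlgebraicClosure (v.adicCompletion ℚ),
      w (Field.absoluteGaloisGroup.toAlgEquiv (v.adicCompletion ℚ) σ x) = w x := by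
    intro x
    apply NNReal.coe_injective
    rw [hw, hw]
    exact (spectralNorm_eq_of_equiv (Field.absoluteGaloisGroup.toAlgEquiv (v.adicCompletion ℚ) σ) x).symm
  -- `σ t = ± t`
  have hsqσ : (σ • t) ^ 2 = t ^ 2 := by
    rw [Field.absoluteGaloisGroup.smul_def, ← map_pow, ht, AlgEquiv.commutes]
  have hcases : σ • t = t ∨ σ • t = -t := by
    have h0 : (σ • t - t) * (σ • t + t) = 0 := by
      have : (σ • t - t) * (σ • t + t) = (σ • t) ^ 2 - t ^ 2 := by ring
      rw [this, hsqσ, sub_self]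
    rcases mul_eq_zero.mp h0 with h | h
    · exact Or.inl (sub_eq_zero.mp h)
    · exact Or.inr (eq_neg_of_add_eq_zero_left h)
  rcases hcases with h | h
  · exact h
  · exfalso
    -- `σ` swaps the two roots
    have h' : Field.absoluteGaloisGroup.toAlgEquiv (v.adicCompletion ℚ) σ t = -t := by
      rw [← Field.absoluteGaloisGroup.smul_def]; exact h
    have hσT : Field.absoluteGaloisGroup.toAlgEquiv (v.adicCompletion ℚ) σ (T t) = T (-t) := by
      simp only [hT]
      rw [map_div₀, map_sub, map_mul, map_mul, map_mul, map_intCast, map_intCast, map_intCast,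
        map_ofNat, h']
    have hweq : w (T (-t)) = w (T t) := by rw [← hσT, hwσ]
    have hboth : w (T t) < 1 ∧ w (T (-t)) < 1 := by
      rcases hone with h1 | h1
      · exact ⟨h1, hweq ▸ h1⟩
      · exact ⟨hweq ▸ h1, h1⟩
    have hlt : w (T t + T (-t)) < 1 :=
      lt_of_le_of_lt (Valuation.map_add w _ _) (max_lt hboth.1 hboth.2)
    rw [hsum, Valuation.map_neg, hwa₁] at hlt
    exact lt_irrefl _ hlt

/-- The same in Mathlib's `AlgEquiv` spelling: at a split multiplicative `2`, `toAlgEquiv σ t = t` for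
every `σ ∈ Γ_{ℚ_v}` — the form consumed by the twisted Tate parametrisation's sign
`if toAlgEquiv σ t = t then 1 else −1`. [cite: SilvermanATAEC1994, Ch. V Thm. 5.3 (a),(b), Cor. 5.4] -/
theorem toAlgEquiv_sqrt_gamma_eq_of_split_two (hsp : W.HasSplitMultiplicativeReductionAtPrime 2)
    (h2v : ((2 : ℕ) : 𝓞 ℚ) ∈ v.asIdeal) (t : AlgebraicClosure (v.adicCompletion ℚ))
    (ht : t ^ 2 = algebraMap (v.adicCompletion ℚ) (AlgebraicClosure (v.adicCompletion ℚ))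
      (algebraMap ℚ (v.adicCompletion ℚ) (-(W.c₄ / W.c₆))))
    (σ : absoluteGaloisGroup (v.adicCompletion ℚ)) :
    Field.absoluteGaloisGroup.toAlgEquiv (v.adicCompletion ℚ) σ t = t := by
  rw [← Field.absoluteGaloisGroup.smul_def]
  exact smul_sqrt_gamma_eq_of_split_two W hsp h2v t ht σ

/-- **At a split multiplicative `2` the twisted Tate parametrisation is `Γ_{ℚ₂}`-equivariant**:
`σ • Ψ(u) = Ψ(σ u)` for every `σ` (the sign `χ(σ) = σt/t` of Silverman V.5.2 (c)/Cor. V.5.4 is `1`).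
[cite: SilvermanATAEC1994, Ch. V Lemma 5.2 (c), Thm. 5.3 (a),(b), Cor. 5.4] -/
theorem equivariant_of_split_two (hsp : W.HasSplitMultiplicativeReductionAtPrime 2)
    (h2v : ((2 : ℕ) : 𝓞 ℚ) ∈ v.asIdeal) (t : AlgebraicClosure (v.adicCompletion ℚ))
    (ht : t ^ 2 = algebraMap (v.adicCompletion ℚ) (AlgebraicClosure (v.adicCompletion ℚ))
      (algebraMap ℚ (v.adicCompletion ℚ) (-(W.c₄ / W.c₆))))
    (Ψ : Additive (AlgebraicClosure (v.adicCompletion ℚ))ˣ →+ localPoints W (v.adicCompletion ℚ))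
    (hΨσ : ∀ (σ : absoluteGaloisGroup (v.adicCompletion ℚ))
        (u : (AlgebraicClosure (v.adicCompletion ℚ))ˣ),
      σ • Ψ (Additive.ofMul u) =
        (if Field.absoluteGaloisGroup.toAlgEquiv (v.adicCompletion ℚ) σ t = t then (1 : ℤ)
          else -1) •
        Ψ (Additive.ofMul (Units.map
          (Field.absoluteGaloisGroup.toAlgEquiv (v.adicCompletion ℚ) σ :
            AlgebraicClosure (v.adicCompletion ℚ) →* AlgebraicClosure (v.adicCompletion ℚ)) u))) :
    ∀ (σ : absoluteGaloisGroup (v.adicCompletion ℚ)) (u : (AlgebraicClosure (v.adicCompletion ℚ))ˣ),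
      σ • Ψ (Additive.ofMul u) =
        Ψ (Additive.ofMul (Units.map
          (Field.absoluteGaloisGroup.toAlgEquiv (v.adicCompletion ℚ) σ :
            AlgebraicClosure (v.adicCompletion ℚ) →* AlgebraicClosure (v.adicCompletion ℚ)) u)) := by
  intro σ u
  rw [hΨσ σ u, if_pos (toAlgEquiv_sqrt_gamma_eq_of_split_two W hsp h2v t ht σ), one_zsmul]

end Split

end Summit.BirchSwinnertonDyer.BirchSwinnertonDyer.Theorems.MultTransportAtTwo

end
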